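import Mathlib
import Literature.MathematicalPhysics.QuantumLattice.WilsonDiracAP
import Literature.Probability.LatticeModels.TorusFourierProofs

/-!
# Bloch–Floquet factorisation of a period-2 Wilson–Dirac determinant
(helper for crux stmt-QuantumFields-9734, line `Sketch`, stub `stub_blochFactorisation`)

On the even torus `(ℤ/2M)⁴` let `W(x,μ) := Wc(x mod 2, μ)` (parities of `ZMod.val`) be the period-2 extension
of a `U(N)` field `Wc` on the cell `(ℤ/2)⁴`.  Then `det D_W[W] = ∏_{k ∈ {0,…,M-1}⁴} det B_k` with
`B_k := wilsonDirac ρ (e ↦ ζ_k(e.2) Wc e) m r` the tree's operator on the SMALL torus `(ℤ/2)⁴` and the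
constant central phases `ζ_k(μ) = e^{iπk_μ/M}·1` (`stub_blochFactorisation`).  Proof: the half-range Bloch
waves restricted to parity classes, `P((x,i,α),((b,j,β),k)) = [x mod 2 = b] δ_{ij} δ_{αβ} χ_k(x)`,
`χ_k = torusChar (k_ν : ZMod 2M)_ν`, satisfy (1) `D_W[W] P = P · blockDiagonal B` (`wilsonDirac_mul_blochP`:
by the tree's `wilsonDirac_eq` it suffices to intertwine the hopping matrices, `hopFwd_mul_blochP`,
`hopBwd_mul_blochP`; a hop `x ↦ x ± e_μ` multiplies `χ_k` by `e^{±iπk_μ/M}` — no case split at the wrap,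
`χ_k` being a character of `(ℤ/2M)⁴` — parities commute with shifts, and `ρ(ζW) = e^{iπk_μ/M} W`,
`ρ((ζW)⁻¹) = e^{-iπk_μ/M} W⁻¹`); (2) `Pᴴ P = M⁴ • 1` (`blochP_conjTranspose_mul_self`: inside a parity
class `x_ν = 2q_ν + val b_ν`, `q ∈ (Fin M)⁴`, and `Σ_{t<M} e^{2πi(k-k')t/M} = M δ_{kk'}`); (3) the index
types are equinumerous, so `det D = det (blockDiagonal B) = ∏_k det B_k` (`det_eq_of_intertwine`).
References: Bloch–Floquet reduction of periodic operators (folklore); Montvay–Münster, *Quantum Fields on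
a Lattice* §4.2 (Wilson fermions in momentum space).  Pure theorem file (no `def`s): the intermediate
lemmas take `ρ, U, Us, P` as variables with defining hypotheses `hρ, hU, hUs, hP`, instantiated by `rfl`.
-/

noncomputable section

open scoped BigOperators Classical Matrix ComplexConjugate
open Finset
open Literature.MathematicalPhysics.QuantumLattice Literature.MathematicalPhysics.QuantumFieldTheory
  Literature.Probability.LatticeModels

namespace Summit.QuantumFields.QCD.Cruxes.CriticalLineDiamagnetism.ChessboardCellGain
namespace BlochFactorisation

open Complex (I)
open Literature.MathematicalPhysics (QuantumFieldTheory.Site.shift)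

/-- If `Pᴴ P = c • 1` with `c ≠ 0`, `D P = P B` and the index types are equinumerous (`e : ι ≃ κ`), then
`det D = det B`: along `e` the matrix `P` becomes square, `P'ᴴ D P' = c • B'` and `det P'ᴴ det P' = cⁿ`. -/
theorem det_eq_of_intertwine {ι κ : Type*} [Fintype ι] [Fintype κ] [DecidableEq ι] [DecidableEq κ]
    (D : Matrix ι ι ℂ) (B : Matrix κ κ ℂ) (P : Matrix ι κ ℂ) (e : ι ≃ κ) (c : ℂ) (hc : c ≠ 0)
    (hP : Pᴴ * P = c • (1 : Matrix κ κ ℂ)) (hDP : D * P = P * B) : D.det = B.det := by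
  set P' : Matrix ι ι ℂ := P.submatrix id e with hP'
  have h1 : P'ᴴ * P' = c • (1 : Matrix ι ι ℂ) := by
    rw [hP', Matrix.conjTranspose_submatrix, ← Matrix.submatrix_mul _ _ _ _ _ Function.bijective_id, hP]
    simp only [Matrix.submatrix_smul, Pi.smul_apply, Matrix.submatrix_one_equiv]
  have h2 : D * P' = P' * B.submatrix e e := by
    rw [hP', Matrix.submatrix_mul_equiv P B id e e, ← hDP,
      Matrix.submatrix_mul _ _ _ _ _ Function.bijective_id, Matrix.submatrix_id_id]
  have h4 := congrArg Matrix.det (show P'ᴴ * D * P' = c • B.submatrix e e by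
    rw [Matrix.mul_assoc, h2, ← Matrix.mul_assoc, h1, Matrix.smul_mul, Matrix.one_mul])
  rw [Matrix.det_mul, Matrix.det_mul, Matrix.det_smul, Matrix.det_submatrix_equiv_self] at h4
  have h5 : (P'ᴴ).det * P'.det = c ^ Fintype.card ι := by
    rw [← Matrix.det_mul, h1, Matrix.det_smul, Matrix.det_one, mul_one]
  refine mul_left_cancel₀ (pow_ne_zero (Fintype.card ι) hc) ?_
  rw [← h4, ← h5]; ring

section BlochWaves

variable {N M : ℕ} [NeZero M] (m r : ℝ) (Wc : GaugeConfig 4 2 (Matrix.unitaryGroup (Fin N) ℂ))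
  (ζ : (Fin 4 → Fin M) → Fin 4 → Matrix.unitaryGroup (Fin N) ℂ)
  (hζ : ∀ k μ, ((ζ k μ : Matrix.unitaryGroup (Fin N) ℂ) : Matrix (Fin N) (Fin N) ℂ) =
    Complex.exp (Real.pi * Complex.I * ((k μ : ℕ) : ℂ) / (M : ℂ)) • (1 : Matrix (Fin N) (Fin N) ℂ))
  (ρ : Matrix.unitaryGroup (Fin N) ℂ →* Matrix (Fin N) (Fin N) ℂ) (hρ : ρ = unitaryFundamentalRep (Fin N) ℂ)
  (U : GaugeConfig 4 (2 * M) (Matrix.unitaryGroup (Fin N) ℂ))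
  (hU : U = fun e : Edge 4 (2 * M) => Wc (fun ν => (((e.1 ν).val : ℕ) : ZMod 2), e.2))
  (Us : (Fin 4 → Fin M) → GaugeConfig 4 2 (Matrix.unitaryGroup (Fin N) ℂ)) (hUs : Us = fun k e => ζ k e.2 * Wc e)
  (P : Matrix (TorusSite 4 (2 * M) × Fin N × Fin 4) ((TorusSite 4 2 × Fin N × Fin 4) × (Fin 4 → Fin M)) ℂ)
  (hP : P = Matrix.of fun p q => if ((fun ν => (((p.1 ν).val : ℕ) : ZMod 2)), p.2) = q.1 then
    torusChar (fun ν => ((q.2 ν : ℕ) : ZMod (2 * M))) p.1 else 0)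

/-! ### Parities, half-range Bloch characters and central phases -/

/-- The parity `val a mod 2` of `a : ℤ/2M` is the ring homomorphism `ZMod.castHom (2 ∣ 2M)`. -/
theorem parity_eq_castHom (a : ZMod (2 * M)) :
    ((a.val : ℕ) : ZMod 2) = ZMod.castHom (dvd_mul_right 2 M) (ZMod 2) a := by
  rw [ZMod.castHom_apply, ZMod.cast_eq_val]

/-- The parity vector of the unit vector `e_μ ∈ (ℤ/2M)⁴` is the unit vector `e_μ ∈ (ℤ/2)⁴`. -/
theorem parity_single (μ : Fin 4) :
    (fun ν => ((((Pi.single μ 1 : TorusSite 4 (2 * M)) ν).val : ℕ) : ZMod 2)) = Pi.single μ 1 := by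
  funext ν
  by_cases h : ν = μ
  · subst h; rw [Pi.single_eq_same, Pi.single_eq_same, parity_eq_castHom, map_one]
  · rw [Pi.single_eq_of_ne h, Pi.single_eq_of_ne h, ZMod.val_zero, Nat.cast_zero]

/-- Parities commute with the forward shift `x ↦ x + e_μ`. -/
theorem parity_shift (x : TorusSite 4 (2 * M)) (μ : Fin 4) :
    (fun ν => ((((QuantumFieldTheory.Site.shift x μ) ν).val : ℕ) : ZMod 2)) =
      QuantumFieldTheory.Site.shift (fun ν => (((x ν).val : ℕ) : ZMod 2)) μ := by
  unfold QuantumFieldTheory.Site.shift; rw [← parity_single (M := M)]; funext ν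
  simp only [Pi.add_apply, parity_eq_castHom, map_add]

/-- Parities commute with the backward shift `x ↦ x - e_μ`. -/
theorem parity_sub_single (x : TorusSite 4 (2 * M)) (μ : Fin 4) :
    (fun ν => ((((x - Pi.single μ 1 : TorusSite 4 (2 * M)) ν).val : ℕ) : ZMod 2)) =
      (fun ν => (((x ν).val : ℕ) : ZMod 2)) - Pi.single μ 1 := by
  rw [← parity_single (M := M)]; funext ν; simp only [Pi.sub_apply, parity_eq_castHom, map_sub]

/-- The Bloch character of half-range momentum `k ∈ {0,…,M-1}⁴` at a unit vector: `χ_k(e_μ) = e^{iπk_μ/M}`;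
hence `χ_k(x ± e_μ) = χ_k(x) e^{±iπk_μ/M}` by `torusChar_add_right` / `torusChar_sub_right`. -/
theorem blochChar_single (k : Fin 4 → Fin M) (μ : Fin 4) :
    torusChar (fun ν => ((k ν : ℕ) : ZMod (2 * M))) (Pi.single μ 1) =
      Complex.exp (Real.pi * Complex.I * ((k μ : ℕ) : ℂ) / (M : ℂ)) := by
  unfold torusChar
  rw [Finset.prod_eq_single μ (fun ν _ hν => by rw [Pi.single_eq_of_ne hν, mul_zero, AddChar.map_zero_eq_one])
    (fun h => absurd (Finset.mem_univ μ) h), Pi.single_eq_same, mul_one, ZMod.stdAddChar_apply,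
    ZMod.toCircle_natCast]
  have hM : (M : ℂ) ≠ 0 := Nat.cast_ne_zero.2 (NeZero.ne M)
  congr 1; push_cast; field_simp

/-- Left multiplication by a central phase `↑z = θ • 1` in `U(n)`: `↑(z W)_{ij} = θ W_{ij}`. -/
theorem coe_phase_mul_apply {n : Type*} [Fintype n] [DecidableEq n] (θ : ℂ) (z W : Matrix.unitaryGroup n ℂ)
    (hz : (z : Matrix n n ℂ) = θ • 1) (i j : n) :
    ((z * W : Matrix.unitaryGroup n ℂ) : Matrix n n ℂ) i j = θ * (W : Matrix n n ℂ) i j := by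
  rw [Matrix.UnitaryGroup.mul_val, hz, Matrix.smul_mul, Matrix.one_mul, Matrix.smul_apply, smul_eq_mul]

/-- Group inverse of a phase-twisted unitary: `↑((z W)⁻¹)_{ij} = conj θ · ↑(W⁻¹)_{ij}` for `↑z = θ • 1`. -/
theorem coe_phase_mul_inv_apply {n : Type*} [Fintype n] [DecidableEq n] (θ : ℂ) (z W : Matrix.unitaryGroup n ℂ)
    (hz : (z : Matrix n n ℂ) = θ • 1) (i j : n) : (((z * W)⁻¹ : Matrix.unitaryGroup n ℂ) : Matrix n n ℂ) i j =
      conj θ * ((W⁻¹ : Matrix.unitaryGroup n ℂ) : Matrix n n ℂ) i j := by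
  rw [_root_.mul_inv_rev, Matrix.UnitaryGroup.mul_val, Matrix.UnitaryGroup.inv_apply z, hz,
    Matrix.star_eq_conjTranspose, Matrix.conjTranspose_smul, Matrix.conjTranspose_one, Matrix.mul_smul,
    Matrix.mul_one, Matrix.smul_apply, smul_eq_mul, Complex.star_def]

/-! ### Orthogonality of the Bloch waves on a parity class -/

/-- Summing over a parity class of `(ℤ/2M)⁴` is summing over `q ∈ (Fin M)⁴`, `x_ν = 2q_ν + val b_ν`
(coordinatewise, the bijection `ℤ/2M ≃ ℤ/2 × Fin M`, `a ↦ (val a mod 2, ⌊val a/2⌋)`). -/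
theorem sum_parity_class (b : TorusSite 4 2) (F : TorusSite 4 (2 * M) → ℂ) :
    ∑ x : TorusSite 4 (2 * M), (if (fun ν => (((x ν).val : ℕ) : ZMod 2)) = b then F x else 0) =
      ∑ q : Fin 4 → Fin M, F (fun ν => ((2 * (q ν : ℕ) + (b ν).val : ℕ) : ZMod (2 * M))) := by
  have hdiv : ∀ a : ZMod (2 * M), a.val / 2 < M := fun a => by have := ZMod.val_lt a; omega
  let E : ZMod (2 * M) ≃ ZMod 2 × Fin M := ⟨fun a => (((a.val : ℕ) : ZMod 2), ⟨a.val / 2, hdiv a⟩),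
    fun y => ((2 * (y.2 : ℕ) + y.1.val : ℕ) : ZMod (2 * M)),
    fun a => by simp only [ZMod.val_natCast, Nat.div_add_mod, ZMod.natCast_zmod_val], fun ⟨b₀, q⟩ => by
      have hb := ZMod.val_lt b₀
      have hlt : 2 * (q : ℕ) + b₀.val < 2 * M := by omega
      simp only [ZMod.val_natCast_of_lt hlt, Prod.mk.injEq]
      refine ⟨?_, Fin.ext (by simp only; omega)⟩
      rw [Nat.cast_add, Nat.cast_mul, ZMod.natCast_self, zero_mul, zero_add, ZMod.natCast_zmod_val]⟩
  let e4 : TorusSite 4 (2 * M) ≃ (Fin 4 → ZMod 2) × (Fin 4 → Fin M) :=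
    (Equiv.piCongrRight fun _ : Fin 4 => E).trans (Equiv.arrowProdEquivProdArrow _ _ _)
  have hpar : ∀ (b' : Fin 4 → ZMod 2) (q : Fin 4 → Fin M),
      (fun ν => ((((e4.symm (b', q)) ν).val : ℕ) : ZMod 2)) = b' := fun b' q => by
    funext ν
    show (E (E.symm (b' ν, q ν))).1 = b' ν
    rw [Equiv.apply_symm_apply]
  rw [← e4.symm.sum_comp, Fintype.sum_prod_type]
  simp_rw [hpar, Finset.sum_ite_irrel, Finset.sum_const_zero, Finset.sum_ite_eq', Finset.mem_univ, if_true]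
  rfl

/-- Geometric sums of non-trivial `M`-th roots of unity vanish: `Σ_{t<M} e^{2πi j t/M} = 0` for `M ∤ j`. -/
theorem sum_exp_eq_zero (j : ℤ) (hj : ¬ (M : ℤ) ∣ j) :
    ∑ t : Fin M, Complex.exp (2 * Real.pi * I * (j : ℂ) * ((t : ℕ) : ℂ) / (M : ℂ)) = 0 := by
  have hM : (M : ℂ) ≠ 0 := Nat.cast_ne_zero.2 (NeZero.ne M)
  set ω : ℂ := Complex.exp (2 * Real.pi * I * (j : ℂ) / (M : ℂ)) with hω
  have hωM : ω ^ M = 1 := by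
    rw [hω, ← Complex.exp_nat_mul, show (M : ℂ) * (2 * Real.pi * I * (j : ℂ) / (M : ℂ)) =
      (j : ℂ) * (2 * Real.pi * I) by field_simp]
    exact Complex.exp_int_mul_two_pi_mul_I j
  have hω1 : ω ≠ 1 := fun h => by
    obtain ⟨n, hn⟩ := Complex.exp_eq_one_iff.1 h
    have h2 : (2 * Real.pi * I : ℂ) ≠ 0 := by simp [Real.pi_ne_zero, Complex.I_ne_zero]
    rw [div_eq_iff hM] at hn
    have h3 : (j : ℂ) = (n : ℂ) * (M : ℂ) := mul_left_cancel₀ h2 (by rw [hn]; ring)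
    exact hj ⟨n, by exact_mod_cast h3.trans (mul_comm _ _)⟩
  calc ∑ t : Fin M, Complex.exp (2 * Real.pi * I * (j : ℂ) * ((t : ℕ) : ℂ) / (M : ℂ))
      = ∑ t ∈ range M, ω ^ t := by
        rw [← Fin.sum_univ_eq_sum_range]
        refine Finset.sum_congr rfl fun t _ => ?_
        rw [hω, ← Complex.exp_nat_mul]; congr 1; ring
    _ = 0 := by rw [geom_sum_eq hω1, hωM, sub_self, zero_div]

/-- One-dimensional orthogonality on a parity class: for `k, k' < M` and any offset `b₀`,
`Σ_{t<M} conj e(k'(2t+b₀)) · e(k(2t+b₀)) = M δ_{kk'}`, `e = ZMod.stdAddChar` on `ℤ/2M`. -/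
theorem sum_char_parity_line (k k' : Fin M) (b₀ : ℕ) :
    ∑ t : Fin M, conj (ZMod.stdAddChar (((k' : ℕ) : ZMod (2 * M)) * ((2 * (t : ℕ) + b₀ : ℕ) : ZMod (2 * M))) : ℂ) *
        (ZMod.stdAddChar (((k : ℕ) : ZMod (2 * M)) * ((2 * (t : ℕ) + b₀ : ℕ) : ZMod (2 * M))) : ℂ) =
      if k = k' then (M : ℂ) else 0 := by
  by_cases hk : k = k'
  · subst hk
    simp_rw [Complex.conj_mul', ZMod.stdAddChar_apply, Circle.norm_coe]
    simp
  rw [if_neg hk]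
  have hM : (M : ℂ) ≠ 0 := Nat.cast_ne_zero.2 (NeZero.ne M)
  have hterm : ∀ t : Fin M,
      conj (ZMod.stdAddChar (((k' : ℕ) : ZMod (2 * M)) * ((2 * (t : ℕ) + b₀ : ℕ) : ZMod (2 * M))) : ℂ) *
        (ZMod.stdAddChar (((k : ℕ) : ZMod (2 * M)) * ((2 * (t : ℕ) + b₀ : ℕ) : ZMod (2 * M))) : ℂ) =
      Complex.exp (2 * Real.pi * I * ((((k : ℤ) - (k' : ℤ) : ℤ)) : ℂ) * (b₀ : ℂ) / (2 * (M : ℂ))) *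
        Complex.exp (2 * Real.pi * I * ((((k : ℤ) - (k' : ℤ) : ℤ)) : ℂ) * ((t : ℕ) : ℂ) / (M : ℂ)) := by
    intro t
    rw [← AddChar.map_neg_eq_conj, ← AddChar.map_add_eq_mul,
      show -(((k' : ℕ) : ZMod (2 * M)) * ((2 * (t : ℕ) + b₀ : ℕ) : ZMod (2 * M))) +
          ((k : ℕ) : ZMod (2 * M)) * ((2 * (t : ℕ) + b₀ : ℕ) : ZMod (2 * M)) =
        ((((k : ℤ) - (k' : ℤ)) * (2 * (t : ℕ) + b₀) : ℤ) : ZMod (2 * M)) by push_cast; ring,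
      ZMod.stdAddChar_apply, ZMod.toCircle_intCast, ← Complex.exp_add]
    congr 1; push_cast; field_simp; ring
  have hdvd : ¬ (M : ℤ) ∣ ((k : ℤ) - (k' : ℤ)) := fun h => by
    have hlt : |((k : ℕ) : ℤ) - ((k' : ℕ) : ℤ)| < (M : ℤ) := by rw [abs_lt]; constructor <;> omega
    have h0 := Int.eq_zero_of_abs_lt_dvd h hlt
    exact hk (Fin.ext (by omega))
  simp_rw [hterm]
  rw [← Finset.mul_sum, sum_exp_eq_zero _ hdvd, mul_zero]

/-- **Orthogonality of the half-range Bloch waves restricted to a parity class**: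
`Σ_{x ∈ (ℤ/2M)⁴, x mod 2 = b} conj χ_{k'}(x) χ_k(x) = M⁴ δ_{kk'}` for `k, k' ∈ {0,…,M-1}⁴`. -/
theorem sum_parity_class_char (b : TorusSite 4 2) (k k' : Fin 4 → Fin M) :
    ∑ x : TorusSite 4 (2 * M), (if (fun ν => (((x ν).val : ℕ) : ZMod 2)) = b then
      conj (torusChar (fun ν => ((k' ν : ℕ) : ZMod (2 * M))) x) * torusChar (fun ν => ((k ν : ℕ) : ZMod (2 * M))) x
      else 0) =
      if k = k' then (M : ℂ) ^ 4 else 0 := by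
  rw [sum_parity_class]
  have hfac : ∀ q : Fin 4 → Fin M,
      conj (torusChar (fun ν => ((k' ν : ℕ) : ZMod (2 * M))) (fun ν => ((2 * (q ν : ℕ) + (b ν).val : ℕ) : ZMod (2 * M)))) *
        torusChar (fun ν => ((k ν : ℕ) : ZMod (2 * M))) (fun ν => ((2 * (q ν : ℕ) + (b ν).val : ℕ) : ZMod (2 * M))) =
      ∏ ν, conj (ZMod.stdAddChar (((k' ν : ℕ) : ZMod (2 * M)) *
            ((2 * (q ν : ℕ) + (b ν).val : ℕ) : ZMod (2 * M))) : ℂ) *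
          (ZMod.stdAddChar (((k ν : ℕ) : ZMod (2 * M)) * ((2 * (q ν : ℕ) + (b ν).val : ℕ) : ZMod (2 * M))) : ℂ) := by
    intro q
    unfold torusChar
    rw [map_prod, ← Finset.prod_mul_distrib]
  simp_rw [hfac]
  rw [← Fintype.prod_sum fun ν (t : Fin M) =>
    conj (ZMod.stdAddChar (((k' ν : ℕ) : ZMod (2 * M)) * ((2 * (t : ℕ) + (b ν).val : ℕ) : ZMod (2 * M))) : ℂ) *
      (ZMod.stdAddChar (((k ν : ℕ) : ZMod (2 * M)) * ((2 * (t : ℕ) + (b ν).val : ℕ) : ZMod (2 * M))) : ℂ)]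
  simp_rw [sum_char_parity_line]
  rw [Finset.prod_ite_zero, Finset.prod_const, Finset.card_univ, Fintype.card_fin]
  by_cases hk : k = k'
  · simp [hk]
  · rw [if_neg hk, if_neg (fun h => hk (funext fun ν => h ν (Finset.mem_univ ν)))]

/-! ### The Bloch waves block-diagonalise the period-2 operator -/

include hP in
/-- Right action of a block-diagonal matrix on the Bloch waves:
`(P · blockDiagonal F)((x,i,α), (s,k)) = χ_k(x) F_k((x mod 2, i, α), s)`. -/
theorem blochP_mul_blockDiagonal_apply
    (F : (Fin 4 → Fin M) → Matrix (TorusSite 4 2 × Fin N × Fin 4) (TorusSite 4 2 × Fin N × Fin 4) ℂ)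
    (p : TorusSite 4 (2 * M) × Fin N × Fin 4) (q : (TorusSite 4 2 × Fin N × Fin 4) × (Fin 4 → Fin M)) :
    (P * Matrix.blockDiagonal F) p q = torusChar (fun ν => ((q.2 ν : ℕ) : ZMod (2 * M))) p.1 *
      F q.2 ((fun ν => (((p.1 ν).val : ℕ) : ZMod 2)), p.2) q.1 := by
  subst hP
  obtain ⟨s, k⟩ := q
  rw [Matrix.mul_apply, Fintype.sum_prod_type, Finset.sum_eq_single ((fun ν => (((p.1 ν).val : ℕ) : ZMod 2)), p.2)]
  · rw [Finset.sum_eq_single k]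
    · rw [Matrix.of_apply, if_pos rfl, Matrix.blockDiagonal_apply_eq]
    · exact fun k' _ hk' => by rw [Matrix.blockDiagonal_apply_ne _ _ _ hk', mul_zero]
    · exact fun h => absurd (Finset.mem_univ _) h
  · exact fun s' _ hs' => Finset.sum_eq_zero fun k' _ => by rw [Matrix.of_apply, if_neg (Ne.symm hs'), zero_mul]
  · exact fun h => absurd (Finset.mem_univ _) h

include hP in
/-- Left action on the Bloch waves of a matrix whose row `p` is supported on the single site `y p`:
`(A P)(p, ((b,c),k)) = [y p mod 2 = b] g(p, c) χ_k(y p)`. -/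
theorem rowHop_mul_blochP_apply
    (A : Matrix (TorusSite 4 (2 * M) × Fin N × Fin 4) (TorusSite 4 (2 * M) × Fin N × Fin 4) ℂ)
    (y : TorusSite 4 (2 * M) × Fin N × Fin 4 → TorusSite 4 (2 * M))
    (g : TorusSite 4 (2 * M) × Fin N × Fin 4 → Fin N × Fin 4 → ℂ)
    (hA : ∀ p p', A p p' = if p'.1 = y p then g p p'.2 else 0) (p : TorusSite 4 (2 * M) × Fin N × Fin 4)
    (q : (TorusSite 4 2 × Fin N × Fin 4) × (Fin 4 → Fin M)) :
    (A * P) p q = if (fun ν => (((y p ν).val : ℕ) : ZMod 2)) = q.1.1 then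
      g p q.1.2 * torusChar (fun ν => ((q.2 ν : ℕ) : ZMod (2 * M))) (y p) else 0 := by
  subst hP
  obtain ⟨⟨b, c⟩, k⟩ := q
  rw [Matrix.mul_apply, Fintype.sum_prod_type, Finset.sum_eq_single (y p)]
  · simp only [hA, Matrix.of_apply, if_true]
    by_cases h : (fun ν => (((y p ν).val : ℕ) : ZMod 2)) = b
    · rw [if_pos h, Finset.sum_eq_single c]
      · rw [if_pos (show ((fun ν => (((y p ν).val : ℕ) : ZMod 2)), c) = (b, c) by rw [h])]
      · exact fun c' _ hc => by rw [if_neg (fun h' => hc (Prod.mk.inj h').2), mul_zero]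
      · exact fun h' => absurd (Finset.mem_univ _) h'
    · rw [if_neg h]
      exact Finset.sum_eq_zero fun c' _ => by rw [if_neg (fun h' => h (Prod.mk.inj h').1), mul_zero]
  · exact fun x' _ hx' => Finset.sum_eq_zero fun c' _ => by rw [hA, if_neg hx', zero_mul]
  · exact fun h => absurd (Finset.mem_univ _) h

include hζ hρ hU hUs hP in
/-- **Forward hops intertwine**: `H⁺_μ[W] P = P · blockDiagonal_k H⁺_μ[ζ_k Wc]`. -/
theorem hopFwd_mul_blochP (μ : Fin 4) :
    wilsonHopFwd ρ U r μ * P = P * Matrix.blockDiagonal fun k => wilsonHopFwd ρ (Us k) r μ := by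
  ext ⟨x, i, α⟩ ⟨⟨b, j, β⟩, k⟩
  rw [rowHop_mul_blochP_apply P hP (wilsonHopFwd ρ U r μ) (fun p => QuantumFieldTheory.Site.shift p.1 μ)
    (fun p c => ((r : ℂ) • (1 : Matrix (Fin 4) (Fin 4) ℂ) - euclideanGamma μ) p.2.2 c.2 * ρ (U (p.1, μ)) p.2.1 c.1)
    (fun _ _ => rfl), blochP_mul_blockDiagonal_apply P hP]
  subst hρ hU hUs
  simp only [wilsonHopFwd, Matrix.of_apply, unitaryFundamentalRep_apply]
  rw [parity_shift]
  unfold QuantumFieldTheory.Site.shift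
  rw [torusChar_add_right, blochChar_single, coe_phase_mul_apply _ _ _ (hζ k μ)]
  by_cases h : b = (fun ν => (((x ν).val : ℕ) : ZMod 2)) + Pi.single μ 1
  · rw [if_pos h.symm, if_pos h]; ring
  · rw [if_neg (Ne.symm h), if_neg h, mul_zero]

include hζ hρ hU hUs hP in
/-- **Backward hops intertwine**: `H⁻_μ[W] P = P · blockDiagonal_k H⁻_μ[ζ_k Wc]`. -/
theorem hopBwd_mul_blochP (μ : Fin 4) :
    wilsonHopBwd ρ U r μ * P = P * Matrix.blockDiagonal fun k => wilsonHopBwd ρ (Us k) r μ := by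
  have he : ∀ z y : TorusSite 4 (2 * M), z = QuantumFieldTheory.Site.shift y μ ↔ y = z - Pi.single μ 1 :=
    fun z y => by unfold QuantumFieldTheory.Site.shift; rw [eq_sub_iff_add_eq, eq_comm]
  have hrow : ∀ p p' : TorusSite 4 (2 * M) × Fin N × Fin 4, wilsonHopBwd ρ U r μ p p' =
      if p'.1 = p.1 - Pi.single μ 1 then ((r : ℂ) • (1 : Matrix (Fin 4) (Fin 4) ℂ) + euclideanGamma μ) p.2.2 p'.2.2 *
        ρ (U (p.1 - Pi.single μ 1, μ))⁻¹ p.2.1 p'.2.1 else 0 := by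
    intro p p'
    by_cases h : p'.1 = p.1 - Pi.single μ 1
    · simp only [wilsonHopBwd, Matrix.of_apply, he, if_pos h]; rw [h]
    · simp only [wilsonHopBwd, Matrix.of_apply, he, if_neg h]
  ext ⟨x, i, α⟩ ⟨⟨b, j, β⟩, k⟩
  rw [rowHop_mul_blochP_apply P hP (wilsonHopBwd ρ U r μ) (fun p => p.1 - Pi.single μ 1)
    (fun p c => ((r : ℂ) • (1 : Matrix (Fin 4) (Fin 4) ℂ) + euclideanGamma μ) p.2.2 c.2 *
      ρ (U (p.1 - Pi.single μ 1, μ))⁻¹ p.2.1 c.1) (by exact hrow), blochP_mul_blockDiagonal_apply P hP]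
  subst hρ hU hUs
  simp only [wilsonHopBwd, Matrix.of_apply, unitaryFundamentalRep_apply]
  rw [parity_sub_single, torusChar_sub_right, blochChar_single, coe_phase_mul_inv_apply _ _ _ (hζ k μ)]
  have he' : (fun ν => (((x ν).val : ℕ) : ZMod 2)) = QuantumFieldTheory.Site.shift b μ ↔
      (fun ν => (((x ν).val : ℕ) : ZMod 2)) - Pi.single μ 1 = b := by
    unfold QuantumFieldTheory.Site.shift; rw [sub_eq_iff_eq_add]
  by_cases h : (fun ν => (((x ν).val : ℕ) : ZMod 2)) - Pi.single μ 1 = b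
  · rw [if_pos h, if_pos (he'.2 h), h]; ring
  · rw [if_neg h, if_neg (fun h' => h (he'.1 h')), mul_zero]

include hζ hρ hU hUs hP in
/-- **The Bloch waves block-diagonalise the period-2 Wilson–Dirac operator**:
`D_W[W] P = P · blockDiagonal_k D_W^{(2)}[ζ_k Wc]`. -/
theorem wilsonDirac_mul_blochP :
    wilsonDirac ρ U m r * P = P * Matrix.blockDiagonal fun k => wilsonDirac ρ (Us k) m r := by
  have hbd : (Matrix.blockDiagonal fun k => wilsonDirac ρ (Us k) m r) = ((m + 4 * r : ℝ) : ℂ) • 1 -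
      (1 / 2 : ℂ) • ∑ μ : Fin 4, ((Matrix.blockDiagonal fun k => wilsonHopFwd ρ (Us k) r μ) +
        Matrix.blockDiagonal fun k => wilsonHopBwd ρ (Us k) r μ) := by
    ext ik jk
    simp only [Matrix.blockDiagonal_apply, wilsonDirac_eq, Matrix.sub_apply, Matrix.smul_apply,
      Matrix.one_apply, Matrix.sum_apply, Matrix.add_apply, smul_eq_mul, Prod.ext_iff]
    by_cases h : ik.2 = jk.2 <;> simp [h]
  rw [hbd, wilsonDirac_eq]
  simp only [Matrix.sub_mul, Matrix.mul_sub, Matrix.smul_mul, Matrix.mul_smul, Matrix.one_mul,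
    Matrix.mul_one, Matrix.sum_mul, Matrix.mul_sum, Matrix.add_mul, Matrix.mul_add,
    hopFwd_mul_blochP r Wc ζ hζ ρ hρ U hU Us hUs P hP, hopBwd_mul_blochP r Wc ζ hζ ρ hρ U hU Us hUs P hP]

include hP in
/-- **Orthogonality of the Bloch waves**: `Pᴴ P = M⁴ • 1`. -/
theorem blochP_conjTranspose_mul_self : Pᴴ * P = ((M : ℂ) ^ 4) • 1 := by
  subst hP
  ext ⟨s', k'⟩ ⟨s, k⟩
  rw [Matrix.mul_apply, Matrix.smul_apply, Matrix.one_apply, Fintype.sum_prod_type, smul_eq_mul]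
  simp only [Matrix.conjTranspose_apply, Matrix.of_apply]
  by_cases hs : s' = s
  · subst hs
    have key : ∀ (c : Prop) [Decidable c] (u v : ℂ),
        star (if c then u else 0) * (if c then v else 0) = if c then conj u * v else 0 := by
      intros; split_ifs <;> simp
    have key2 : ∀ (x : TorusSite 4 (2 * M)) (v : ℂ),
        ∑ c : Fin N × Fin 4, (if ((fun ν => (((x ν).val : ℕ) : ZMod 2)), c) = s' then v else 0) =
          if (fun ν => (((x ν).val : ℕ) : ZMod 2)) = s'.1 then v else 0 := by
      intro x v
      obtain ⟨b, c₀⟩ := s'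
      simp only [Prod.mk.injEq]
      by_cases h : (fun ν => (((x ν).val : ℕ) : ZMod 2)) = b
      · simp only [h, true_and, Finset.sum_ite_eq', Finset.mem_univ, if_true]
      · simp only [h, false_and, if_false, Finset.sum_const_zero]
    simp_rw [key, key2, sum_parity_class_char]
    by_cases hk : k = k'
    · subst hk; simp
    · rw [if_neg hk, if_neg (fun h => hk (Prod.mk.inj h).2.symm), mul_zero]
  · rw [if_neg (fun h => hs (Prod.mk.inj h).1), mul_zero]
    refine Finset.sum_eq_zero fun x _ => Finset.sum_eq_zero fun c _ => ?_
    by_cases h1 : ((fun ν => (((x ν).val : ℕ) : ZMod 2)), c) = s'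
    · rw [if_neg (fun h2 : ((fun ν => (((x ν).val : ℕ) : ZMod 2)), c) = s => hs (h1.symm.trans h2)), mul_zero]
    · rw [if_neg h1, star_zero, zero_mul]

end BlochWaves
end BlochFactorisation

open BlochFactorisation in
/-- **Stub `stub_blochFactorisation` (Bloch–Floquet factorisation).**  On the even torus `(ℤ/2M)⁴` the
Wilson–Dirac determinant of the period-2 link field `W(x,μ) = Wc(x mod 2, μ)` is the product over the
`M⁴` Bloch momenta `k ∈ {0,…,M-1}⁴` of the determinants of the tree's `wilsonDirac` on the small torus
`(ℤ/2)⁴` for the phase-twisted fields `e ↦ ζ_k(e.2) Wc(e)`, `ζ_k(μ) = e^{iπk_μ/M}·1`. -/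
theorem stub_blochFactorisation :
    ∀ (N M : ℕ) [NeZero M] (m r : ℝ) (Wc : GaugeConfig 4 2 (Matrix.unitaryGroup (Fin N) ℂ))
      (ζ : (Fin 4 → Fin M) → Fin 4 → Matrix.unitaryGroup (Fin N) ℂ),
      (∀ k μ, ((ζ k μ : Matrix.unitaryGroup (Fin N) ℂ) : Matrix (Fin N) (Fin N) ℂ) =
        Complex.exp (Real.pi * Complex.I * ((k μ : ℕ) : ℂ) / (M : ℂ)) • (1 : Matrix (Fin N) (Fin N) ℂ)) →
      (wilsonDirac (unitaryFundamentalRep (Fin N) ℂ)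
          (fun e : Edge 4 (2 * M) => Wc (fun ν => (((e.1 ν).val : ℕ) : ZMod 2), e.2)) m r).det =
        ∏ k : Fin 4 → Fin M,
          (wilsonDirac (unitaryFundamentalRep (Fin N) ℂ) (fun e : Edge 4 2 => ζ k e.2 * Wc e) m r).det := by
  intro N M _ m r Wc ζ hζ
  rw [← Matrix.det_blockDiagonal]
  exact det_eq_of_intertwine _ _ _ (Fintype.equivOfCardEq (by
      simp only [Fintype.card_prod, Fintype.card_fun, ZMod.card, Fintype.card_fin]; ring)) _
    (pow_ne_zero 4 (Nat.cast_ne_zero.2 (NeZero.ne M))) (blochP_conjTranspose_mul_self _ rfl)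
    (wilsonDirac_mul_blochP m r Wc ζ hζ _ rfl _ rfl _ rfl _ rfl)

end Summit.QuantumFields.QCD.Cruxes.CriticalLineDiamagnetism.ChessboardCellGain

end
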